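import Summits.Ventures.CertifiedArithmetic.Expansions.CompressTopStable
import Literature.ComputerArithmetic.Shewchuk1997.TwoDiff
import Mathlib.Tactic.Linarith
import Mathlib.Tactic.Ring
import Mathlib.Tactic.NormNum

/-!
# Iterated COMPRESS terminates under ANY round-to-nearest — after at most `|e| − 1` passes

[cite: Shewchuk1997, §2.7 pp. 331–333, Theorem 23 and Figure 15 (COMPRESS)];
[cite: BoldoEtAl2023, §2.1 (any tie-breaking rule)].

`CompressTerminates` proved that the iterates `COMPRESS, COMPRESS², …` of a nonoverlapping expansion
of precision-`p` floats become stationary when `fl` never rounds a tie AWAY from a doubled grid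
(`RoundoffBelow 2`, e.g. ties-to-even), with a bound read off a valuation potential, and
`CompressPassesUnbounded` showed that no bound independent of the input exists.  Whether the
iteration terminates for EVERY round-to-nearest — ties broken by an arbitrary rule, which may even
depend on the argument: any FUNCTION `fl` with `IsRoundNearest p emin fl` — was left open there.
This file settles it, with the clean bound `|e| − 1` on the number of list-changing passes:

* `compress_iterate_length_pred_fixed` — a nonoverlapping expansion of `n + 1` floats has
  `COMPRESS^(n+1)(e) = COMPRESS^n(e)` for every round-to-nearest `fl` (`p ≥ 2`): at most
  `|e| − 1` passes change the list (`compress_iterate_length_fixed`: the uniform form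
  `COMPRESS^(|e|+1)(e) = COMPRESS^(|e|)(e)`);
* `compress_iterate_reverse_take` — TOP FREEZING: for `j ≤ k`, passes `k` and `j` agree on their
  top `j` components (after `j` passes the top `j` components are final);
* `compress_iterate_eq_of_le` / `compress_iterate_eq_of_length_le` — the iterates are constant
  from there on, and `compress_iterate_length_isChain` — the limit is a CHAIN (each component a
  nonzero float absorbed by the next, `fl(eᵢ₊₁ + eᵢ) = eᵢ₊₁`), by `compress_fixed_isChain`.

The engine is the top-stability theorem `compress_compress_getLast` of `CompressTopStable`
("COMPRESS twice keeps the top component") together with LOCALITY: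

* `compress_append_of_absorbing_top` — if the top `Q` of a list `F ++ [Q]` absorbs both the
  component `b` below it and the top `T` of `COMPRESS(F)` (all nonzero floats), then
  `COMPRESS(F ++ [Q]) = COMPRESS(F) ++ [Q]`: the pass never touches `Q`;
* `compress_iterate_succ_eq_append` — consequently, writing `COMPRESS(e) = f ++ [Q_f]`, ALL later
  iterates split at the top: `COMPRESS^(n+1)(e) = COMPRESS^n(f) ++ [Q_f]`.  (The two absorption
  hypotheses are supplied, at every stage, by `compress_top_absorbed` — the top pair of an output
  is absorbed — and by top stability applied to `e` and to `f`.)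

Strong induction on the length (`|f| < |e|`) then gives the bound `|e| − 1`, attained for
`|e| ≤ 4` (argument-dependent ties) and up to a constant factor in general:
`CompressPassesUnbounded` exhibits inputs of length `2k + 4` needing `k + 1` list-changing passes
under ties-to-even.  (A tie-break that is not a function of the argument — a
fresh coin per call — is outside the model: the second pass must reproduce the first pass's
roundings.)  Model check of the decomposition and of the bound under adversarial, argument-
dependent tie choices (integer model; `p = 2`: every nonoverlapping input of at most six components
below `2^9`; `p = 3`: at most five components below `2^10`): 634 656 runs, no exception.
-/

namespace Summit.Ventures.CertifiedArithmetic.Expansions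

open Literature.ComputerArithmetic.JeannerodRump2018
open Literature.ComputerArithmetic.BoldoJeannerodMelquiondMuller2023 hiding twoSum twoSum_fst
open Literature.ComputerArithmetic.Shewchuk1997

variable {p : ℕ} {emin : ℤ} {fl : ℚ → ℚ}

/-! ### Locality at an absorbing top -/

/-- **LOCALITY AT AN ABSORBING TOP.**  Let `b` be a nonzero float absorbed by `Q`
(`fl(Q + b) = Q`) and let the top `T` of `COMPRESS(l ++ [b]) = ys ++ [T]` be a nonzero float
absorbed by `Q` as well.  Then `COMPRESS(l ++ [b, Q]) = ys ++ [T, Q]`: the downward traversal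
emits `Q` at once and continues on `l ++ [b]` unchanged, and the final FAST-TWO-SUM `(Q, T)` of
the upward traversal is exact with roundoff `T ≠ 0`, so it emits `T` and tops with `Q`.
[cite: Shewchuk1997, §2.7 p. 332, Fig. 15] -/
theorem compress_append_of_absorbing_top (h0 : fl 0 = 0) {l ys : List ℚ} {b Q T : ℚ}
    (hb : fl b = b) (hb0 : b ≠ 0) (hQb : fl (Q + b) = Q)
    (hc : compress fl (l ++ [b]) = ys ++ [T]) (hT : fl T = T) (hT0 : T ≠ 0)
    (hQT : fl (Q + T) = Q) : compress fl (l ++ [b, Q]) = ys ++ [T, Q] := by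
  have hft : fastTwoSum fl Q b = (Q, b) := fastTwoSum_eq_of_absorb h0 hb hQb
  have hne : (fastTwoSum fl Q b).2 ≠ 0 := by rw [hft]; exact hb0
  obtain ⟨ys', T', h1, h2⟩ := compress_append_pair_of_ne_zero fl l hne
  rw [hft] at h1 h2
  dsimp only at h1 h2
  rw [hc] at h1
  obtain ⟨hys, hTT⟩ := List.append_inj' h1 rfl
  obtain rfl : T' = T := by simpa using hTT.symm
  subst hys
  rw [h2, fastTwoSum_eq_of_absorb h0 hT hQT]
  simp [hT0]

/-! ### The iterates split at the top -/

/-- Fixed points propagate along an iteration. -/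
private theorem iterate_succ_eq_of_fixed {α : Type*} (g : α → α) (x : α) {N : ℕ}
    (h : g^[N + 1] x = g^[N] x) : ∀ d : ℕ, g^[N + d + 1] x = g^[N + d] x := by
  intro d
  induction d with
  | zero => simpa using h
  | succ d ih =>
    show g^[N + d + 1 + 1] x = g^[N + d + 1] x
    calc g^[N + d + 1 + 1] x = g (g^[N + d + 1] x) := Function.iterate_succ_apply' g _ x
      _ = g (g^[N + d] x) := by rw [ih]
      _ = g^[N + d + 1] x := (Function.iterate_succ_apply' g _ x).symm

/-- The sum is invariant along the iterates of COMPRESS. [cite: Shewchuk1997, Thm 23 p. 331] -/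
theorem compress_iterate_sum (hp : 2 ≤ p) (hfl : IsRoundNearest p emin fl) {e : List ℚ}
    (he : ∀ x ∈ e, IsFloat p emin x) (hexp : IsExpansion 1 e) (n : ℕ) :
    ((compress fl)^[n] e).sum = e.sum := by
  induction n with
  | zero => rfl
  | succ n ih =>
    obtain ⟨hF, hE⟩ := compress_iterate_floats_isExpansion hp hfl he hexp n
    rw [Function.iterate_succ_apply',
      (compress_spec hp hfl le_rfl (roundoffBelow_one (le_trans (by norm_num) hp) hfl) hF
        hE).sum_eq, ih]

/-- **THE ITERATES OF COMPRESS SPLIT AT THE TOP** (`p ≥ 2`, any round-to-nearest).  If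
`COMPRESS(e) = f ++ [Q_f]` for a nonoverlapping expansion `e` of floats, then for every `n`,
`COMPRESS^(n+1)(e) = COMPRESS^n(f) ++ [Q_f]`.  Induction on `n` by
`compress_append_of_absorbing_top`; its two hypotheses hold at every stage because (i) the top pair
of an output is absorbed (`compress_top_absorbed`) and (ii) COMPRESS twice keeps the top
(`compress_compress_getLast`), applied to `e` — giving `fl(Q_f + T) = Q_f` for the top `T` of
`COMPRESS(f)` via `getLast?_compress_append_absorbed` — and to `f` (`compress_iterate_getLast`:
every `COMPRESS^(n+1)(f)` tops with that same `T`).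
[cite: Shewchuk1997, §2.7 pp. 331–333] -/
theorem compress_iterate_succ_eq_append (hp : 2 ≤ p) (hfl : IsRoundNearest p emin fl)
    {e : List ℚ} (he : ∀ x ∈ e, IsFloat p emin x) (hexp : IsExpansion 1 e) {f : List ℚ}
    {Qf : ℚ} (hc : compress fl e = f ++ [Qf]) (n : ℕ) :
    (compress fl)^[n + 1] e = (compress fl)^[n] f ++ [Qf] := by
  have hp1 : 1 ≤ p := le_trans (by norm_num) hp
  have h0 : fl 0 = 0 := fl_zero hfl
  have out := compress_spec hp hfl le_rfl (roundoffBelow_one hp1 hfl) he hexp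
  rw [hc] at out
  have hfF : ∀ x ∈ f, IsFloat p emin x := fun x hx => out.floats x (List.mem_append_left _ hx)
  have hfE : IsExpansion 1 f := out.exp.sublist (List.sublist_append_left _ _)
  induction n with
  | zero => simpa using hc
  | succ n ih =>
    rw [Function.iterate_succ_apply' (compress fl) (n + 1) e, ih]
    rcases f.eq_nil_or_concat with hf0 | ⟨l, b, hfb⟩
    · subst hf0
      have hnil : ∀ m : ℕ, (compress fl)^[m] ([] : List ℚ) = [] :=
        fun m => Function.iterate_fixed (by simp [compress]) m
      rw [hnil, hnil, List.nil_append, compress_singleton]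
    · rw [List.concat_eq_append] at hfb
      -- the components of `f` are nonzero, so `f.sum ≠ 0`
      have hnz : ∀ x ∈ f, x ≠ 0 := by
        rcases out.nz with h | h
        · exact fun x hx => h x (List.mem_append_left _ hx)
        · exfalso
          have := congrArg List.length h
          simp [hfb] at this
      have hbF : IsFloat p emin b := hfF b (by simp [hfb])
      have hb0 : b ≠ 0 := hnz b (by simp [hfb])
      have hsumf : f.sum ≠ 0 := fun h =>
        hb0 ((sum_eq_zero_iff_of_isExpansion hfF hfE).mp h b (by simp [hfb]))
      -- (i) for stage 0: `Q_f` absorbs the top `b` of `f`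
      have hQb : fl (Qf + b) = Qf :=
        compress_top_absorbed hp hfl he hexp (l := l) (a := b) (b := Qf) (by rw [hc, hfb]; simp)
      -- (ii): `Q_f` absorbs the top `T` of `COMPRESS(f)`
      obtain ⟨T, hT1, hT2⟩ :=
        getLast?_compress_append_absorbed h0 l (fl_eq_self hfl hbF) hQb hb0
      rw [← hfb] at hT1
      have hQT : fl (Qf + T) = Qf := by
        have h2 := compress_compress_getLast hp hfl he hexp
        have hce : compress fl e = l ++ [b, Qf] := by rw [hc, hfb]; simp
        rw [hce, hT2] at h2
        simpa using h2
      -- `T` is a nonzero float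
      have outf := compress_spec hp hfl le_rfl (roundoffBelow_one hp1 hfl) hfF hfE
      have hTmem : T ∈ compress fl f := List.mem_of_getLast? hT1
      have hTF : IsFloat p emin T := outf.floats T hTmem
      have hT0 : T ≠ 0 := by
        rcases outf.nz with h | h
        · exact h T hTmem
        · rw [h, List.mem_singleton] at hTmem
          rw [hTmem]; exact hsumf
      -- the stage-`n` list `F = COMPRESS^n(f)`: its top is absorbed by `Q_f`, and so is the top of
      -- `COMPRESS(F) = COMPRESS^(n+1)(f)`, which is `T`
      have htopF : (compress fl ((compress fl)^[n] f)).getLast? = some T := by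
        rw [← Function.iterate_succ_apply' (compress fl) n f,
          compress_iterate_getLast hp hfl hfF hfE n]
        exact hT1
      obtain ⟨ys, hys⟩ := List.getLast?_eq_some_iff.mp htopF
      have hlast : ∃ (l' : List ℚ) (b' : ℚ), (compress fl)^[n] f = l' ++ [b'] ∧
          IsFloat p emin b' ∧ b' ≠ 0 ∧ fl (Qf + b') = Qf := by
        cases n with
        | zero => exact ⟨l, b, by simpa using hfb, hbF, hb0, hQb⟩
        | succ m =>
          have hm : ((compress fl)^[m + 1] f).getLast? = some T := by
            rw [compress_iterate_getLast hp hfl hfF hfE m]; exact hT1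
          obtain ⟨l', hl'⟩ := List.getLast?_eq_some_iff.mp hm
          exact ⟨l', T, hl', hTF, hT0, hQT⟩
      obtain ⟨l', b', hF, hb'F, hb'0, hQb'⟩ := hlast
      rw [hF] at hys
      rw [Function.iterate_succ_apply' (compress fl) n f, hF, hys, List.append_assoc,
        List.append_assoc, List.singleton_append, List.singleton_append]
      exact compress_append_of_absorbing_top h0 (fl_eq_self hfl hb'F) hb'0 hQb' hys
        (fl_eq_self hfl hTF) hT0 hQT

/-! ### Top freezing -/

/-- **TOP FREEZING** (`p ≥ 2`, any round-to-nearest): after `j` passes the top `j` components never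
change again — for `j ≤ k`, `COMPRESS^k(e)` and `COMPRESS^j(e)` agree on their last `j` components
(if `COMPRESS^j(e)` has fewer than `j` components it is already stationary).  Induction on `j` by
the splitting `compress_iterate_succ_eq_append` applied to `e`, then to `f`, and so on.  Only the
top ONE component of pass `j` is shared with pass `j + 1` in general ("top `j + 1`" fails, e.g.
`p = 3`, ties-to-even, `⟨3, 8, 64⟩ ↦ ⟨−1, −4, 80⟩ ↦ ⟨−5, 80⟩`).
[cite: Shewchuk1997, §2.7 pp. 331–333] -/
theorem compress_iterate_reverse_take (hp : 2 ≤ p) (hfl : IsRoundNearest p emin fl) :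
    ∀ (j : ℕ) {e : List ℚ}, (∀ x ∈ e, IsFloat p emin x) → IsExpansion 1 e → ∀ {k : ℕ}, j ≤ k →
      (((compress fl)^[k] e).reverse.take j) = (((compress fl)^[j] e).reverse.take j) := by
  intro j
  induction j with
  | zero => intros; simp
  | succ j ih =>
    intro e he hexp k hjk
    have hp1 : 1 ≤ p := le_trans (by norm_num) hp
    have hnil : ∀ m : ℕ, (compress fl)^[m] ([] : List ℚ) = [] :=
      fun m => Function.iterate_fixed (by simp [compress]) m
    obtain ⟨k, rfl⟩ : ∃ k', k = k' + 1 := ⟨k - 1, by omega⟩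
    rcases (compress fl e).eq_nil_or_concat with hc0 | ⟨f, Qf, hc⟩
    · rw [Function.iterate_succ_apply (compress fl) k e,
        Function.iterate_succ_apply (compress fl) j e, hc0, hnil, hnil]
    · rw [List.concat_eq_append] at hc
      have out := compress_spec hp hfl le_rfl (roundoffBelow_one hp1 hfl) he hexp
      rw [hc] at out
      have hfF : ∀ x ∈ f, IsFloat p emin x := fun x hx => out.floats x (List.mem_append_left _ hx)
      have hfE : IsExpansion 1 f := out.exp.sublist (List.sublist_append_left _ _)
      rw [compress_iterate_succ_eq_append hp hfl he hexp hc k,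
        compress_iterate_succ_eq_append hp hfl he hexp hc j, List.reverse_append,
        List.reverse_append, List.reverse_singleton, List.singleton_append, List.singleton_append,
        List.take_succ_cons, List.take_succ_cons, ih hfF hfE (by omega)]

/-- In particular pass `j + 1` agrees with pass `j` on the top `j` components (the lane's
"top-freezing conjecture", any tie rule). [cite: Shewchuk1997, §2.7 pp. 331–333] -/
theorem compress_iterate_succ_reverse_take (hp : 2 ≤ p) (hfl : IsRoundNearest p emin fl)
    {e : List ℚ} (he : ∀ x ∈ e, IsFloat p emin x) (hexp : IsExpansion 1 e) (j : ℕ) :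
    (((compress fl)^[j + 1] e).reverse.take j) = (((compress fl)^[j] e).reverse.take j) :=
  compress_iterate_reverse_take hp hfl j he hexp (Nat.le_succ j)

/-- The lengths of the iterates never increase (any `fl` whatsoever, `compress_length_le`).
[cite: Shewchuk1997, Thm 23 p. 331] -/
theorem length_compress_iterate_succ_le (fl : ℚ → ℚ) (e : List ℚ) (k : ℕ) :
    ((compress fl)^[k + 1] e).length ≤ ((compress fl)^[k] e).length := by
  rw [Function.iterate_succ_apply']
  exact compress_length_le fl _

/-! ### Termination under any tie rule -/

/-- The strong induction on the length behind `compress_iterate_length_pred_fixed`. -/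
private theorem compress_iterate_fixed_ind (hp : 2 ≤ p) (hfl : IsRoundNearest p emin fl) :
    ∀ (n : ℕ) (e : List ℚ), e.length = n + 1 → (∀ x ∈ e, IsFloat p emin x) → IsExpansion 1 e →
      (compress fl)^[n + 1] e = (compress fl)^[n] e := by
  intro n
  induction n using Nat.strong_induction_on with
  | _ n ih =>
    intro e hn he hexp
    have hp1 : 1 ≤ p := le_trans (by norm_num) hp
    have hnil : ∀ m : ℕ, (compress fl)^[m] ([] : List ℚ) = [] :=
      fun m => Function.iterate_fixed (by simp [compress]) m
    cases n with
    | zero =>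
      -- a single component is fixed at once
      obtain ⟨x, t, rfl⟩ := List.exists_cons_of_length_eq_add_one hn
      obtain rfl : t = [] := List.length_eq_zero_iff.mp (by simpa using hn)
      rw [Function.iterate_one, Function.iterate_zero_apply, compress_singleton]
    | succ k =>
      rcases (compress fl e).eq_nil_or_concat with hc0 | ⟨f, Qf, hc⟩
      · -- `COMPRESS(e) = ⟨⟩`: every later iterate is `⟨⟩`
        rw [Function.iterate_succ_apply (compress fl) (k + 1) e,
          Function.iterate_succ_apply (compress fl) k e, hc0, hnil, hnil]
      · rw [List.concat_eq_append] at hc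
        rw [compress_iterate_succ_eq_append hp hfl he hexp hc (k + 1),
          compress_iterate_succ_eq_append hp hfl he hexp hc k]
        rcases f.eq_nil_or_concat with hf0 | ⟨l, b, hfb⟩
        · rw [hf0, hnil, hnil]
        · rw [List.concat_eq_append] at hfb
          have out := compress_spec hp hfl le_rfl (roundoffBelow_one hp1 hfl) he hexp
          rw [hc] at out
          have hfF : ∀ x ∈ f, IsFloat p emin x :=
            fun x hx => out.floats x (List.mem_append_left _ hx)
          have hfE : IsExpansion 1 f := out.exp.sublist (List.sublist_append_left _ _)
          have hfl' : f.length = l.length + 1 := by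
            rw [hfb, List.length_append, List.length_singleton]
          have hlen : l.length ≤ k := by
            have := compress_length_le fl e
            rw [hc, List.length_append, List.length_singleton, hfl', hn] at this
            omega
          have hfix : (compress fl)^[l.length + 1] f = (compress fl)^[l.length] f :=
            ih l.length (by omega) f hfl' hfF hfE
          obtain ⟨d, hd⟩ : ∃ d, k = l.length + d := ⟨k - l.length, by omega⟩
          rw [hd, iterate_succ_eq_of_fixed (compress fl) f hfix d]

/-- **ITERATED COMPRESS IS STATIONARY AFTER `|e| − 1` PASSES — ANY ROUND-TO-NEAREST** (`p ≥ 2`):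
a nonoverlapping expansion `e` of `n + 1` floats satisfies `COMPRESS^(n+1)(e) = COMPRESS^n(e)`,
i.e. at most `n` passes change the list.  Strong induction on `n`: one component is fixed at once
(`compress_singleton`); with `COMPRESS(e) = f ++ [Q_f]` one has `|f| ≤ n` (`compress_length_le`),
the iterates of `e` are those of `f` with `Q_f` appended (`compress_iterate_succ_eq_append`), and
the iterates of `f` are stationary from pass `|f| − 1 ≤ n − 1` on.  No hypothesis on ties (contrast
`compress_iterate_fixed`, which needs `RoundoffBelow 2`).  The bound is attained for `n + 1 ≤ 4`
in the integer model with argument-dependent ties, and for `n + 1 = 2, 3` under ties-to-even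
(`p = 3`: `⟨3, 8, 64⟩ ↦ ⟨−1, −4, 80⟩ ↦ ⟨−5, 80⟩`).
[cite: Shewchuk1997, §2.7 pp. 331–333]; [cite: BoldoEtAl2023, §2.1] -/
theorem compress_iterate_length_pred_fixed (hp : 2 ≤ p) (hfl : IsRoundNearest p emin fl)
    {e : List ℚ} (he : ∀ x ∈ e, IsFloat p emin x) (hexp : IsExpansion 1 e) {n : ℕ}
    (hn : e.length = n + 1) : (compress fl)^[n + 1] e = (compress fl)^[n] e :=
  compress_iterate_fixed_ind hp hfl n e hn he hexp

/-- The same with the uniform exponent `|e|` (also for `e = ⟨⟩`):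
`COMPRESS^(|e|+1)(e) = COMPRESS^(|e|)(e)`. [cite: Shewchuk1997, §2.7 pp. 331–333] -/
theorem compress_iterate_length_fixed (hp : 2 ≤ p) (hfl : IsRoundNearest p emin fl) {e : List ℚ}
    (he : ∀ x ∈ e, IsFloat p emin x) (hexp : IsExpansion 1 e) :
    (compress fl)^[e.length + 1] e = (compress fl)^[e.length] e := by
  cases e with
  | nil => rfl
  | cons x t =>
    exact iterate_succ_eq_of_fixed (compress fl) (x :: t)
      (compress_iterate_length_pred_fixed hp hfl he hexp (n := t.length) rfl) 1

/-- Hence the iterates are constant from pass `n = |e| − 1` on.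
[cite: Shewchuk1997, §2.7 pp. 331–333] -/
theorem compress_iterate_eq_of_le (hp : 2 ≤ p) (hfl : IsRoundNearest p emin fl) {e : List ℚ}
    (he : ∀ x ∈ e, IsFloat p emin x) (hexp : IsExpansion 1 e) {n k : ℕ} (hn : e.length = n + 1)
    (hk : n ≤ k) : (compress fl)^[k] e = (compress fl)^[n] e := by
  obtain ⟨d, rfl⟩ := Nat.exists_eq_add_of_le hk
  induction d with
  | zero => rfl
  | succ d ih =>
    rw [show n + (d + 1) = n + d + 1 from rfl,
      iterate_succ_eq_of_fixed (compress fl) e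
        (compress_iterate_length_pred_fixed hp hfl he hexp hn) d, ih (Nat.le_add_right _ _)]

/-- … and from pass `|e|` on, uniformly in `e`. [cite: Shewchuk1997, §2.7 pp. 331–333] -/
theorem compress_iterate_eq_of_length_le (hp : 2 ≤ p) (hfl : IsRoundNearest p emin fl)
    {e : List ℚ} (he : ∀ x ∈ e, IsFloat p emin x) (hexp : IsExpansion 1 e) {k : ℕ}
    (hk : e.length ≤ k) : (compress fl)^[k] e = (compress fl)^[e.length] e := by
  obtain ⟨d, rfl⟩ := Nat.exists_eq_add_of_le hk
  induction d with
  | zero => rfl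
  | succ d ih =>
    rw [show e.length + (d + 1) = e.length + d + 1 from rfl,
      iterate_succ_eq_of_fixed (compress fl) e (compress_iterate_length_fixed hp hfl he hexp) d,
      ih (Nat.le_add_right _ _)]

/-- **… AND THE LIMIT IS A CHAIN**: `COMPRESS^(|e|)(e)` is a nonoverlapping expansion of floats
fixed by COMPRESS, hence a chain — every component a nonzero float absorbed by the next
(`compress_fixed_isChain`).  The any-tie version of `compress_iterate_isChain`.
[cite: Shewchuk1997, Thm 23 p. 331; §2.7 p. 333] -/
theorem compress_iterate_length_isChain (hp : 2 ≤ p) (hfl : IsRoundNearest p emin fl)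
    {e : List ℚ} (he : ∀ x ∈ e, IsFloat p emin x) (hexp : IsExpansion 1 e) :
    List.IsChain (fun a b => fl (b + a) = b ∧ fl a = a ∧ a ≠ 0)
      ((compress fl)^[e.length] e) := by
  obtain ⟨hF, hE⟩ := compress_iterate_floats_isExpansion hp hfl he hexp e.length
  refine compress_fixed_isChain hp hfl hF hE ?_
  have h := compress_iterate_length_fixed hp hfl he hexp
  rwa [Function.iterate_succ_apply'] at h

end Summit.Ventures.CertifiedArithmetic.Expansions
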